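import Literature.Probability.LatticeModels.DobrushinShlosmanInfiniteVolume
import HarnessLib

/-!
# The Dobrushin–Shlosman window comparison for a PAIR of measures: a Gibbs measure of `γ` against a
# measure that satisfies the DLR equation only for the USABLE windows (two specifications agreeing
# away from a defect region)

Topic `Literature/Probability/LatticeModels`; theorems only (no definitions, no named facts). Continues
`DobrushinShlosmanInfiniteVolume.lean`, whose two-functional engine `abs_sub_le_of_window` (Dobrushin–Shlosman
1985, Theorem 1, in the Vasserstein form of Föllmer 1988 Ch. I (2.7)–(2.10)) is run here with

* `E₁ = μ`, a Gibbs measure of the specification `γ` carrying the window data (site weight `r ≤ R`,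
  windows `win c` with locality sets `nbhd c`, array `K` with (H1) `hcontract`, locality `hloc`, received
  sums `≤ γ₀ < 1`, `≤ N⋆` windows per site), and
* `E₂ = ν`, ANY probability measure satisfying the DLR equation `ν(γ_{win c} G) = ν(G)` for the windows
  of the USABLE centres `P c` only

(`abs_integral_sub_integral_le_of_window_of_dlrOn`): for a bounded measurable `f` reading the finite set
`Δf ⊆ Λ` with site-Lipschitz vector `δf`, and a profile `ℓ ≥ L₀` on `Δf` such that every window through a
site of positive profile is usable with centre and locality set inside `Λ` and `ℓ` drops by at most one
along the support of `K`:

  `|∫ f dμ − ∫ f dν| ≤ 2 R e^{−(1−γ₀)² L₀ /(2(2γ₀N⋆+1))} Σ_{x ∈ Δf} δf x`.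

The case of record (`abs_integral_sub_integral_le_of_window_pair`): `ν` is a Gibbs measure of a SECOND
specification `γ'` whose window kernels COINCIDE with those of `γ` at the usable centres — Föllmer's
comparison of two specifications (1988, Ch. I, Comparison Theorem (2.8) with the localisation (2.10):
the estimate is governed by the sites where the two local characteristics differ) in the Dobrushin–Shlosman
window setting: the defect of the pair is confined to the unusable windows, and an observable supported at
profile depth `L₀` from them sees the two measures agree up to `2R e^{−κ₁ L₀} Σ δf`. Typical use: `γ'` =
the specification of a locally modified interaction (a source supported in a finite region `S`), usable =
windows not reading `S`; the bound is then the exponential SCREENING of the source in every DLR state,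
with a constant that does not see the size of the modification.

References: R. L. Dobrushin, S. B. Shlosman, in *Statistical Physics and Dynamical Systems* (1985),
Thm. 1; H. Föllmer, *Random fields and diffusion processes*, LNM 1362 (1988), Ch. I, (2.7)–(2.10),
Thm. (2.8), Thm. (2.13); H.-O. Georgii, *Gibbs Measures and Phase Transitions* (2011), §8.2; the tree
file `DobrushinShlosmanInfiniteVolume.lean` (`abs_sub_le_of_window`, followed line by line).
-/

noncomputable section

open MeasureTheory ProbabilityTheory Finset Function
open Literature.Probability.LatticeModels.DobrushinMetric (IsLipBound integrable_of_abs_le')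

namespace Literature.Probability.LatticeModels.DobrushinShlosman

variable {V S : Type*} [MeasurableSpace S]

/-- **The Dobrushin–Shlosman window comparison: a Gibbs measure against a measure that is DLR on the
usable windows** (Dobrushin–Shlosman 1985, Theorem 1, Vasserstein form; Föllmer 1988 Ch. I (2.7)–(2.10)).
Window data of the specification `γ` as in `abs_sub_le_of_window` / `abs_covariance_le_of_window`
(site weight `0 ≤ r ≤ R`, windows `win c ∋ c` inside locality sets `nbhd c`, array `K ≥ 0` supported in
`nbhd c` with the one-boundary-site contraction (H1) `hcontract`, locality `hloc`, received sums `≤ γ₀ < 1`,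
at most `N⋆` windows through a site). Let `μ` be a Gibbs measure of `γ`, `ν` a probability measure with
`∫ (γ_{win c} G) dν = ∫ G dν` for every bounded measurable `Λ`-local `G` and every USABLE centre
(`c ∈ Λ`, `nbhd c ⊆ Λ`, `P c`), `f` bounded measurable reading `Δf ⊆ Λ` with site-Lipschitz vector `δf`,
and `ℓ` a profile with: every window through a site of positive profile is usable, `ℓ` drops by at most
one along the support of `K`, `ℓ ≥ L₀` on `Δf`. Then
`|∫ f dμ − ∫ f dν| ≤ 2 R exp(−(1−γ₀)² L₀/(2(2γ₀N⋆+1))) Σ_{x ∈ Δf} δf x`.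
PROOF: `abs_sub_le_of_window` with `E₁ = ∫ · dμ` (monotone-normalised; invariant under every window
kernel by the DLR equation `IsGibbsMeasure.integral_integral_eq`) and `E₂ = ∫ · dν` (monotone-normalised;
invariant under the usable window kernels by hypothesis), the Lipschitz vector cut down to `Δf`.
[cite: DobrushinShlosman1985, Theorem 1] -/
theorem abs_integral_sub_integral_le_of_window_of_dlrOn [DecidableEq V] {γ : Specification V S}
    (hγ : IsSpecification γ)
    {r : S → S → ℝ} {R : ℝ} (hr0 : ∀ a b, 0 ≤ r a b) (hrR : ∀ a b, r a b ≤ R) (hR : 0 ≤ R)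
    {win nbhd : V → Finset V} {K : V → V → V → ℝ} (hK0 : ∀ c y x, 0 ≤ K c y x)
    (hself : ∀ c, c ∈ win c) (hwin : ∀ c, win c ⊆ nbhd c)
    (hKsupp : ∀ c y x, K c y x ≠ 0 → y ∈ nbhd c)
    (hcontract : ∀ (c y : V), y ∉ win c → ∀ (ω η : V → S), (∀ v, v ≠ y → ω v = η v) →
      ∀ (f : (V → S) → ℝ) (δ : V → ℝ), Measurable f → (∃ B, ∀ σ, |f σ| ≤ B) →
        DependsOn f (win c : Set V) → (∀ x, 0 ≤ δ x) →
        (∀ (x : V) (σ τ : V → S), (∀ v, v ≠ x → σ v = τ v) → |f σ - f τ| ≤ δ x * r (σ x) (τ x)) →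
          |∫ σ, f σ ∂(γ (win c) ω) - ∫ σ, f σ ∂(γ (win c) η)| ≤
            (∑ x ∈ win c, K c y x * δ x) * r (ω y) (η y))
    (hloc : ∀ (c : V) (ζ ζ' : V → S), (∀ v ∈ nbhd c, ζ v = ζ' v) →
      ∀ (f : (V → S) → ℝ), Measurable f → (∃ B, ∀ σ, |f σ| ≤ B) → DependsOn f (win c : Set V) →
        ∫ σ, f σ ∂(γ (win c) ζ) = ∫ σ, f σ ∂(γ (win c) ζ'))
    {γ₀ : ℝ} (hγ₀ : 0 ≤ γ₀) (hγ₁ : γ₀ < 1)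
    (hsum : ∀ c, ∀ x ∈ win c, ∑ y ∈ nbhd c, K c y x ≤ γ₀)
    {Nstar : ℕ} (hN : ∀ (x : V) (G : Finset V), (G.filter fun c => x ∈ win c).card ≤ Nstar)
    {μ : Measure (V → S)} (hμ : IsGibbsMeasure γ μ)
    {ν : Measure (V → S)} [IsProbabilityMeasure ν] (Λ : Finset V) (P : V → Prop)
    (hν : ∀ c, c ∈ Λ → nbhd c ⊆ Λ → P c → ∀ ⦃G : (V → S) → ℝ⦄, Measurable G →
      (∃ B, ∀ σ, |G σ| ≤ B) → DependsOn G (Λ : Set V) →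
        ∫ σ, (∫ τ, G τ ∂(γ (win c) σ)) ∂ν = ∫ σ, G σ ∂ν)
    {f : (V → S) → ℝ} (hfm : Measurable f) {Bf : ℝ} (hBf : ∀ σ, |f σ| ≤ Bf)
    {Δf : Finset V} (hfdep : DependsOn f (Δf : Set V)) {δf : V → ℝ} (hδf : IsLipBound r f δf)
    (hΔf : Δf ⊆ Λ) (ℓ : V → ℕ) (L₀ : ℕ)
    (hU : ∀ x, ℓ x ≠ 0 → ∀ c, x ∈ win c → c ∈ Λ ∧ nbhd c ⊆ Λ ∧ P c)
    (hℓ : ∀ c x y, x ∈ win c → K c y x ≠ 0 → ℓ x ≤ ℓ y + 1) (hL : ∀ x ∈ Δf, L₀ ≤ ℓ x) :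
    |∫ σ, f σ ∂μ - ∫ σ, f σ ∂ν| ≤
      2 * R * Real.exp (-((1 - γ₀) ^ 2 / (2 * (2 * γ₀ * Nstar + 1)) * L₀)) * ∑ x ∈ Δf, δf x := by
  -- adapted from `DobrushinShlosman.abs_covariance_le_of_window` (the two functionals are now two measures)
  classical
  haveI := hμ.isProbabilityMeasure
  obtain ⟨τ₀, -⟩ := nonempty_of_measure_ne_zero (μ := μ) (s := Set.univ) (by simp)
  -- `E₁ = μ`: monotone-normalised, invariant under every window kernel (DLR)
  have h₁le : ∀ ⦃F : (V → S) → ℝ⦄ ⦃M : ℝ⦄, Measurable F → (∃ B, ∀ σ, |F σ| ≤ B) →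
      DependsOn F (Λ : Set V) → (∀ σ, F σ ≤ M) → ∫ σ, F σ ∂μ ≤ M := by
    rintro F M hFm ⟨B, hB⟩ - hM
    calc ∫ σ, F σ ∂μ ≤ ∫ _σ, M ∂μ := integral_mono (integrable_of_abs_le' hFm hB) (integrable_const M) hM
      _ = M := by simp
  have h₁ge : ∀ ⦃F : (V → S) → ℝ⦄ ⦃M : ℝ⦄, Measurable F → (∃ B, ∀ σ, |F σ| ≤ B) →
      DependsOn F (Λ : Set V) → (∀ σ, M ≤ F σ) → M ≤ ∫ σ, F σ ∂μ := by
    rintro F M hFm ⟨B, hB⟩ - hM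
    calc M = ∫ _σ, M ∂μ := by simp
      _ ≤ ∫ σ, F σ ∂μ := integral_mono (integrable_const M) (integrable_of_abs_le' hFm hB) hM
  have h₁T : ∀ c, c ∈ Λ → nbhd c ⊆ Λ → P c → ∀ ⦃F : (V → S) → ℝ⦄, Measurable F →
      (∃ B, ∀ σ, |F σ| ≤ B) → DependsOn F (Λ : Set V) →
        ∫ σ, (fun σ => ∫ τ, F τ ∂(γ (win c) σ)) σ ∂μ = ∫ σ, F σ ∂μ := by
    rintro c - - - F hFm ⟨B, hB⟩ -
    exact hμ.integral_integral_eq hγ (win c) (integrable_of_abs_le' hFm hB)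
  -- `E₂ = ν`: monotone-normalised, invariant under the usable window kernels (hypothesis)
  have h₂le : ∀ ⦃F : (V → S) → ℝ⦄ ⦃M : ℝ⦄, Measurable F → (∃ B, ∀ σ, |F σ| ≤ B) →
      DependsOn F (Λ : Set V) → (∀ σ, F σ ≤ M) → ∫ σ, F σ ∂ν ≤ M := by
    rintro F M hFm ⟨B, hB⟩ - hM
    calc ∫ σ, F σ ∂ν ≤ ∫ _σ, M ∂ν := integral_mono (integrable_of_abs_le' hFm hB) (integrable_const M) hM
      _ = M := by simp
  have h₂ge : ∀ ⦃F : (V → S) → ℝ⦄ ⦃M : ℝ⦄, Measurable F → (∃ B, ∀ σ, |F σ| ≤ B) →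
      DependsOn F (Λ : Set V) → (∀ σ, M ≤ F σ) → M ≤ ∫ σ, F σ ∂ν := by
    rintro F M hFm ⟨B, hB⟩ - hM
    calc M = ∫ _σ, M ∂ν := by simp
      _ ≤ ∫ σ, F σ ∂ν := integral_mono (integrable_const M) (integrable_of_abs_le' hFm hB) hM
  have h₂T : ∀ c, c ∈ Λ → nbhd c ⊆ Λ → P c → ∀ ⦃F : (V → S) → ℝ⦄, Measurable F →
      (∃ B, ∀ σ, |F σ| ≤ B) → DependsOn F (Λ : Set V) →
        ∫ σ, (fun σ => ∫ τ, F τ ∂(γ (win c) σ)) σ ∂ν = ∫ σ, F σ ∂ν :=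
    fun c hc hn hP F hFm hFb hFdep => hν c hc hn hP hFm hFb hFdep
  -- the comparison theorem for `f` with its Lipschitz vector cut down to `Δf`
  have hfdepΛ : DependsOn f (Λ : Set V) :=
    hfdep.mono fun v hv => Finset.mem_coe.2 (hΔf (Finset.mem_coe.1 hv))
  have hδL : ∀ x, ℓ x < L₀ → (fun x => if x ∈ Δf then δf x else 0) x = 0 := fun x hx => by
    dsimp only
    split_ifs with hxΔ
    · exact absurd (hL x hxΔ) (not_le.2 hx)
    · rfl
  have key := abs_sub_le_of_window hγ hr0 hrR hR hK0 hself hwin hKsupp hcontract hloc hγ₀ hγ₁ hsum hN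
    Λ τ₀ P (E₁ := fun F => ∫ σ, F σ ∂μ) (E₂ := fun F => ∫ σ, F σ ∂ν) h₁le h₁ge h₁T h₂le h₂ge h₂T ℓ L₀
    hU hℓ hfm hBf hfdepΛ (hδf.restrict hfdep) hδL
  have hs : ∑ x ∈ Λ, (if x ∈ Δf then δf x else 0) = ∑ x ∈ Δf, δf x := by
    rw [Finset.sum_ite_mem, Finset.inter_eq_right.2 hΔf]
  rw [hs] at key
  exact key

/-- **The Dobrushin–Shlosman window comparison for TWO SPECIFICATIONS whose window kernels agree at the
usable centres** (Föllmer 1988 Ch. I, Comparison Theorem (2.8) with the localisation (2.10), in the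
Dobrushin–Shlosman window setting of 1985, Theorem 1). Window data of `γ` as in
`abs_integral_sub_integral_le_of_window_of_dlrOn`; `γ'` a second specification with
`∫ G dγ'_{win c}(σ) = ∫ G dγ_{win c}(σ)` for every usable centre (`P c`), every boundary condition `σ` and
every bounded measurable `G`; `μ` a Gibbs measure of `γ`, `ν` a Gibbs measure of `γ'`. Then for `f`
bounded measurable reading `Δf ⊆ Λ` with site-Lipschitz vector `δf` and a profile `ℓ ≥ L₀` on `Δf`
(windows through sites of positive profile usable with centre and locality set in `Λ`; `ℓ` drops by at most
one along the support of `K`):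
`|∫ f dμ − ∫ f dν| ≤ 2 R exp(−(1−γ₀)² L₀/(2(2γ₀N⋆+1))) Σ_{x ∈ Δf} δf x` — the two DLR states agree, up to
an error exponentially small in the profile depth, on observables supported away from the windows where
the specifications differ; the constant `2R` does not see HOW MUCH they differ there.
[cite: Follmer1988, Ch. I Theorem (2.8) and (2.10)] -/
theorem abs_integral_sub_integral_le_of_window_pair [DecidableEq V] {γ γ' : Specification V S}
    (hγ : IsSpecification γ) (hγ' : IsSpecification γ')
    {r : S → S → ℝ} {R : ℝ} (hr0 : ∀ a b, 0 ≤ r a b) (hrR : ∀ a b, r a b ≤ R) (hR : 0 ≤ R)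
    {win nbhd : V → Finset V} {K : V → V → V → ℝ} (hK0 : ∀ c y x, 0 ≤ K c y x)
    (hself : ∀ c, c ∈ win c) (hwin : ∀ c, win c ⊆ nbhd c)
    (hKsupp : ∀ c y x, K c y x ≠ 0 → y ∈ nbhd c)
    (hcontract : ∀ (c y : V), y ∉ win c → ∀ (ω η : V → S), (∀ v, v ≠ y → ω v = η v) →
      ∀ (f : (V → S) → ℝ) (δ : V → ℝ), Measurable f → (∃ B, ∀ σ, |f σ| ≤ B) →
        DependsOn f (win c : Set V) → (∀ x, 0 ≤ δ x) →
        (∀ (x : V) (σ τ : V → S), (∀ v, v ≠ x → σ v = τ v) → |f σ - f τ| ≤ δ x * r (σ x) (τ x)) →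
          |∫ σ, f σ ∂(γ (win c) ω) - ∫ σ, f σ ∂(γ (win c) η)| ≤
            (∑ x ∈ win c, K c y x * δ x) * r (ω y) (η y))
    (hloc : ∀ (c : V) (ζ ζ' : V → S), (∀ v ∈ nbhd c, ζ v = ζ' v) →
      ∀ (f : (V → S) → ℝ), Measurable f → (∃ B, ∀ σ, |f σ| ≤ B) → DependsOn f (win c : Set V) →
        ∫ σ, f σ ∂(γ (win c) ζ) = ∫ σ, f σ ∂(γ (win c) ζ'))
    {γ₀ : ℝ} (hγ₀ : 0 ≤ γ₀) (hγ₁ : γ₀ < 1)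
    (hsum : ∀ c, ∀ x ∈ win c, ∑ y ∈ nbhd c, K c y x ≤ γ₀)
    {Nstar : ℕ} (hN : ∀ (x : V) (G : Finset V), (G.filter fun c => x ∈ win c).card ≤ Nstar)
    {μ ν : Measure (V → S)} (hμ : IsGibbsMeasure γ μ) (hν : IsGibbsMeasure γ' ν) (P : V → Prop)
    (hagree : ∀ c, P c → ∀ (σ : V → S) ⦃G : (V → S) → ℝ⦄, Measurable G → (∃ B, ∀ τ, |G τ| ≤ B) →
      ∫ τ, G τ ∂(γ' (win c) σ) = ∫ τ, G τ ∂(γ (win c) σ))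
    {f : (V → S) → ℝ} (hfm : Measurable f) {Bf : ℝ} (hBf : ∀ σ, |f σ| ≤ Bf)
    {Δf : Finset V} (hfdep : DependsOn f (Δf : Set V)) {δf : V → ℝ} (hδf : IsLipBound r f δf)
    (Λ : Finset V) (hΔf : Δf ⊆ Λ) (ℓ : V → ℕ) (L₀ : ℕ)
    (hU : ∀ x, ℓ x ≠ 0 → ∀ c, x ∈ win c → c ∈ Λ ∧ nbhd c ⊆ Λ ∧ P c)
    (hℓ : ∀ c x y, x ∈ win c → K c y x ≠ 0 → ℓ x ≤ ℓ y + 1) (hL : ∀ x ∈ Δf, L₀ ≤ ℓ x) :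
    |∫ σ, f σ ∂μ - ∫ σ, f σ ∂ν| ≤
      2 * R * Real.exp (-((1 - γ₀) ^ 2 / (2 * (2 * γ₀ * Nstar + 1)) * L₀)) * ∑ x ∈ Δf, δf x := by
  haveI := hν.isProbabilityMeasure
  refine abs_integral_sub_integral_le_of_window_of_dlrOn hγ hr0 hrR hR hK0 hself hwin hKsupp hcontract hloc
    hγ₀ hγ₁ hsum hN hμ Λ P (fun c _ _ hPc G hGm hGb _ => ?_) hfm hBf hfdep hδf hΔf ℓ L₀ hU hℓ hL
  -- `ν(γ_{win c} G) = ν(γ'_{win c} G) = ν(G)`: the kernels agree at a usable centre, then DLR for `γ'`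
  obtain ⟨B, hB⟩ := hGb
  have h1 : (fun σ => ∫ τ, G τ ∂(γ (win c) σ)) = fun σ => ∫ τ, G τ ∂(γ' (win c) σ) :=
    funext fun σ => (hagree c hPc σ hGm ⟨B, hB⟩).symm
  rw [h1]
  exact hν.integral_integral_eq hγ' (win c) (integrable_of_abs_le' hGm hB)

end Literature.Probability.LatticeModels.DobrushinShlosman

end
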